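import Summits.ValiantsHypothesis.ValiantsHypothesis.Theorems.DivisionGapSquareGridDimersDivisionEasyLayers
import Literature.Computability.AlgebraicComplexity.ArithCircuitProofs
import Literature.Computability.AlgebraicComplexity.IMMInVPProofs

/-!
# Positivity along the layers and circuit size of the layered polynomials

`invS_nextVal`: the positivity invariant (numerators vanish exactly on crossing edges, denominators and
accumulators positive) propagates through a substitution round, so every valuation met is admissible
(`good_of_invS`) and both layered polynomials evaluate to positive, hence nonzero, elements
(`isPos_eval_Φ`).  `complexity_Φ_le : L(Φ m b) ≤ 62 m³` by the substitution bound
`complexity_aeval_le` (`L(f ∘ g) ≤ L(f) + Σ L(gᵢ)`, Bürgisser 2000 Rem. 2.7, tree: IMMInVPProofs) —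
the layered form is what provides sharing. [folklore]

All `def … : Prop` declarations in this file are decidable predicates on finite data (not named facts).
Support file for `SquareGridDimersDivisionEasy` (route DivisionGap, item stmt-ValiantsHypothesis-5072);
the closing theorem is `squareGridDimersDivisionEasy_proof` in `…DivisionGapSquareGridDimersDivisionEasy.lean`.
-/

namespace Summit.ValiantsHypothesis.ValiantsHypothesis.Theorems

namespace SquareGridDimers

set_option linter.dupNamespace false

noncomputable section

open Finset

/-! ## Positivity along the layers -/

section Glue

variable {K : Type*} [CommSemiring K] {P F : Type*} [CommSemiring P] [Field F]
variable (S : PosSys P F) (φ : K →+* F) (n : ℕ)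

/-- The positivity invariant on valuations of the level-`m` variables: numerators vanish exactly on
crossing edges and are positive otherwise; denominators and accumulators are positive. [folklore] -/
def InvS (m : ℕ) (s : VarL m → F) : Prop :=
  (∀ e : E m, (Xing n m (emb e) → s (Sum.inl (e, true)) = 0) ∧
      (¬ Xing n m (emb e) → S.IsPos (s (Sum.inl (e, true))))) ∧
    (∀ e : E m, S.IsPos (s (Sum.inl (e, false)))) ∧
    S.IsPos (s (Sum.inr true)) ∧ S.IsPos (s (Sum.inr false))

variable {S φ n}

/-- Under the invariant the encoded weights vanish exactly on crossing edges. [folklore] -/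
theorem Ws_of_invS {m : ℕ} {s : VarL m → F} (hs : InvS S n m s) (e : E m) :
    (Xing n m (emb e) → Ws s e = 0) ∧ (¬ Xing n m (emb e) → S.IsPos (Ws s e)) := by
  unfold Ws
  exact ⟨fun h => by rw [(hs.1 e).1 h, zero_div], fun h => ((hs.1 e).2 h).div (hs.2.1 e)⟩

/-- Under the invariant every cell factor of the encoded weights is positive. [folklore] -/
theorem isPos_cf_Ws {m : ℕ} (hm : m ≤ n) {s : VarL m → F} (hs : InvS S n m s) (c : Cell m) :
    S.IsPos (cf (Ws s) c) := by
  have hc : (c.1.val, c.2.val).1 < m ∧ (c.1.val, c.2.val).2 < m := ⟨c.1.isLt, c.2.isLt⟩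
  have e1 : Xing n m (emb (c, (1, 0))) ↔ Xing n m (emb (c, (0, 1))) :=
    (xing_opp_iff hm (c.1.val, c.2.val) hc (0, 1))
  have e2 : Xing n m (emb (c, (0, 0))) ↔ Xing n m (emb (c, (1, 1))) :=
    (xing_opp_iff hm (c.1.val, c.2.val) hc (1, 1))
  exact S.isPos_cf_of_xing e1 e2 (not_xing_both hm (c.1.val, c.2.val)) (Ws_of_invS hs _)
    (Ws_of_invS hs _) (Ws_of_invS hs _) (Ws_of_invS hs _)

omit [Field F] in
/-- Evaluations of the cell-factor denominators are products of denominators. [folklore] -/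
theorem isPos_eval_cfd {F' : Type*} [Field F'] (S' : PosSys P F') (φ' : K →+* F') {m : ℕ}
    {s : VarL m → F'} (hs : ∀ e, S'.IsPos (s (Sum.inl (e, false)))) (c : Cell m) :
    S'.IsPos (MvPolynomial.eval₂Hom φ' s (cfd K c)) := by
  rw [eval_cfd]
  exact (((hs _).mul (hs _)).mul (hs _)).mul (hs _)

/-- The level-free index of a numerator edge. [folklore] -/
theorem emb_numEdge {m : ℕ} (e : E m) :
    emb (numEdge e) = (((emb e).1.1 + (emb e).2.1.val, (emb e).1.2 + (emb e).2.2.val), (emb e).2) := by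
  obtain ⟨⟨p, q⟩, ⟨δ, ε⟩⟩ := e
  simp [emb, numEdge, ι, opp, Fin.rev_rev]

/-- **The invariant propagates** through one substitution round. [folklore] -/
theorem invS_nextVal {m : ℕ} (hm : m + 1 ≤ n) {s : VarL (m + 1) → F} (hs : InvS S n (m + 1) s) :
    InvS S n m (nextVal φ s) := by
  have hden := hs.2.1
  have hcfn : ∀ c : Cell (m + 1), S.IsPos (MvPolynomial.eval₂Hom φ s (cfn K c)) := fun c => by
    rw [eval_cfn_eq_cf_mul φ s (fun e => (hden e).ne_zero) c]
    exact (isPos_cf_Ws hm hs c).mul (isPos_eval_cfd S φ hden c)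
  refine ⟨fun e => ?_, fun e => ?_, ?_, ?_⟩
  · have hx : Xing n (m + 1) (emb (numEdge e)) ↔ Xing n m (emb e) := by
      rw [emb_numEdge]
      exact xing_num_iff hm (emb e) ⟨e.1.1.isLt, e.1.2.isLt⟩
    have h := hs.1 (numEdge e)
    simp only [nextVal, Gsub, map_mul, MvPolynomial.eval₂Hom_X', xv]
    exact ⟨fun hX => by rw [h.1 (hx.mpr hX), zero_mul],
      fun hX => (h.2 (fun h' => hX (hx.mp h'))).mul (isPos_eval_cfd S φ hden _)⟩
  · simp only [nextVal, Gsub, map_mul, MvPolynomial.eval₂Hom_X', xv]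
    exact (hden _).mul (hcfn _)
  · simp only [nextVal, Gsub, map_mul, MvPolynomial.eval₂Hom_X', map_prod]
    exact hs.2.2.1.mul (S.isPos_prod _ _ fun c _ => hcfn c)
  · simp only [nextVal, Gsub, map_mul, MvPolynomial.eval₂Hom_X', map_prod]
    exact hs.2.2.2.mul (S.isPos_prod _ _ fun c _ => isPos_eval_cfd S φ hden c)

/-- **The invariant implies admissibility.** [folklore] -/
theorem good_of_invS (m : ℕ) : ∀ s : VarL m → F, m ≤ n → InvS S n m s → Good φ m s := by
  induction m with
  | zero => intro s _ hs; exact hs.2.2.2.ne_zero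
  | succ m ih =>
    intro s hm hs
    exact ⟨hs.2.2.2.ne_zero, fun e => (hs.2.1 e).ne_zero, fun c => (isPos_cf_Ws hm hs c).ne_zero,
      ih _ (by omega) (invS_nextVal hm hs)⟩

/-- **Both layered polynomials evaluate to positive elements** under the invariant. [folklore] -/
theorem isPos_eval_Φ (m : ℕ) : ∀ (s : VarL m → F) (b : Bool), m ≤ n → InvS S n m s →
    S.IsPos (MvPolynomial.eval₂Hom φ s (Φ K m b)) := by
  induction m with
  | zero =>
    intro s b _ hs
    cases b
    · simpa [Φ] using hs.2.2.2
    · simpa [Φ] using hs.2.2.1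
  | succ m ih =>
    intro s b hm hs
    have step : MvPolynomial.eval₂Hom φ s (Φ K (m + 1) b) =
        MvPolynomial.eval₂Hom φ (nextVal φ s) (Φ K m b) := by
      simp only [Φ, MvPolynomial.eval₂Hom_bind₁]
      rfl
    rw [step]
    exact ih _ b (by omega) (invS_nextVal hm hs)

end Glue

/-! ## Circuit size of the layered polynomials -/

section Complexity

open Literature.Computability.AlgebraicComplexity

variable (K : Type*) [CommSemiring K]

/-- A variable costs nothing. [folklore] -/
theorem complexity_xv {m : ℕ} (e : E m) (b : Bool) : complexity (xv K e b) = 0 := complexity_X_holds _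

/-- The cell-factor denominator costs at most `3` gates. [folklore] -/
theorem complexity_cfd_le {m : ℕ} (c : Cell m) : complexity (cfd K c) ≤ 3 := by
  unfold cfd
  calc _ ≤ complexity (xv K (c, (0, 1)) false * xv K (c, (1, 0)) false * xv K (c, (1, 1)) false) +
        complexity (xv K (c, (0, 0)) false) + 1 := complexity_mul_le_holds _ _
    _ ≤ (complexity (xv K (c, (0, 1)) false * xv K (c, (1, 0)) false) +
        complexity (xv K (c, (1, 1)) false) + 1) + 0 + 1 := by
        gcongr
        · exact complexity_mul_le_holds _ _
        · exact (complexity_xv K _ _).le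
    _ ≤ ((complexity (xv K (c, (0, 1)) false) + complexity (xv K (c, (1, 0)) false) + 1) + 0 + 1) + 0 + 1 := by
        gcongr
        · exact complexity_mul_le_holds _ _
        · exact (complexity_xv K _ _).le
    _ = 3 := by simp [complexity_xv]

/-- A product of four variables costs at most `3` gates. [folklore] -/
theorem complexity_mul4_le {m : ℕ} (a₁ a₂ a₃ a₄ : E m × Bool) :
    complexity (xv K a₁.1 a₁.2 * xv K a₂.1 a₂.2 * xv K a₃.1 a₃.2 * xv K a₄.1 a₄.2) ≤ 3 := by
  calc _ ≤ complexity (xv K a₁.1 a₁.2 * xv K a₂.1 a₂.2 * xv K a₃.1 a₃.2) + complexity (xv K a₄.1 a₄.2) + 1 :=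
        complexity_mul_le_holds _ _
    _ ≤ (complexity (xv K a₁.1 a₁.2 * xv K a₂.1 a₂.2) + complexity (xv K a₃.1 a₃.2) + 1) + 0 + 1 := by
        gcongr
        · exact complexity_mul_le_holds _ _
        · exact (complexity_xv K _ _).le
    _ ≤ ((complexity (xv K a₁.1 a₁.2) + complexity (xv K a₂.1 a₂.2) + 1) + 0 + 1) + 0 + 1 := by
        gcongr
        · exact complexity_mul_le_holds _ _
        · exact (complexity_xv K _ _).le
    _ = 3 := by simp [complexity_xv]

/-- The cell-factor numerator costs at most `7` gates. [folklore] -/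
theorem complexity_cfn_le {m : ℕ} (c : Cell m) : complexity (cfn K c) ≤ 7 := by
  unfold cfn
  calc _ ≤ complexity (xv K (c, (0, 1)) true * xv K (c, (1, 0)) true * xv K (c, (1, 1)) false *
          xv K (c, (0, 0)) false) +
        complexity (xv K (c, (1, 1)) true * xv K (c, (0, 0)) true * xv K (c, (0, 1)) false *
          xv K (c, (1, 0)) false) + 1 := complexity_add_le_holds _ _
    _ ≤ 3 + 3 + 1 := by
        gcongr
        · exact complexity_mul4_le K ((c, (0, 1)), true) ((c, (1, 0)), true) ((c, (1, 1)), false)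
            ((c, (0, 0)), false)
        · exact complexity_mul4_le K ((c, (1, 1)), true) ((c, (0, 0)), true) ((c, (0, 1)), false)
            ((c, (1, 0)), false)

/-- The cost of one substitution round: at most `62 (m+1)²` gates in total. [folklore] -/
theorem sum_complexity_Gsub_le (m : ℕ) : ∑ v : VarL m, complexity (Gsub K m v) ≤ 62 * (m + 1) ^ 2 := by
  rw [Fintype.sum_sum_type, Fintype.sum_prod_type, Fintype.sum_bool]
  simp only [Fintype.sum_bool]
  have hE : ∀ e : E m, complexity (Gsub K m (Sum.inl (e, true))) + complexity (Gsub K m (Sum.inl (e, false))) ≤ 12 := by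
    intro e
    have h1 : complexity (Gsub K m (Sum.inl (e, true))) ≤ 4 := by
      simp only [Gsub]
      calc _ ≤ complexity (xv K (numEdge e) true) + complexity (cfd K (numEdge e).1) + 1 :=
            complexity_mul_le_holds _ _
        _ ≤ 0 + 3 + 1 := by
            gcongr
            · exact (complexity_xv K _ _).le
            · exact complexity_cfd_le K _
    have h2 : complexity (Gsub K m (Sum.inl (e, false))) ≤ 8 := by
      simp only [Gsub]
      calc _ ≤ complexity (xv K (numEdge e) false) + complexity (cfn K (numEdge e).1) + 1 :=
            complexity_mul_le_holds _ _
        _ ≤ 0 + 7 + 1 := by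
            gcongr
            · exact (complexity_xv K _ _).le
            · exact complexity_cfn_le K _
    omega
  have hT : complexity (Gsub K m (Sum.inr true)) ≤ 8 * (m + 1) ^ 2 + 1 := by
    simp only [Gsub]
    calc _ ≤ complexity (MvPolynomial.X (Sum.inr true) : MvPolynomial (VarL (m + 1)) K) +
          complexity (∏ c : Cell (m + 1), cfn K c) + 1 := complexity_mul_le_holds _ _
      _ ≤ 0 + (∑ c : Cell (m + 1), complexity (cfn K c) + (univ : Finset (Cell (m + 1))).card) + 1 := by
          gcongr
          · exact (complexity_X_holds _).le
          · exact complexity_finset_prod_le _ _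
      _ ≤ 0 + (∑ _c : Cell (m + 1), 7 + (univ : Finset (Cell (m + 1))).card) + 1 := by
          gcongr with c
          exact complexity_cfn_le K c
      _ = 8 * (m + 1) ^ 2 + 1 := by simp [Finset.card_univ]; ring
  have hF : complexity (Gsub K m (Sum.inr false)) ≤ 4 * (m + 1) ^ 2 + 1 := by
    simp only [Gsub]
    calc _ ≤ complexity (MvPolynomial.X (Sum.inr false) : MvPolynomial (VarL (m + 1)) K) +
          complexity (∏ c : Cell (m + 1), cfd K c) + 1 := complexity_mul_le_holds _ _
      _ ≤ 0 + (∑ c : Cell (m + 1), complexity (cfd K c) + (univ : Finset (Cell (m + 1))).card) + 1 := by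
          gcongr
          · exact (complexity_X_holds _).le
          · exact complexity_finset_prod_le _ _
      _ ≤ 0 + (∑ _c : Cell (m + 1), 3 + (univ : Finset (Cell (m + 1))).card) + 1 := by
          gcongr with c
          exact complexity_cfd_le K c
      _ = 4 * (m + 1) ^ 2 + 1 := by simp [Finset.card_univ]; ring
  have hsum : ∑ e : E m, (complexity (Gsub K m (Sum.inl (e, true))) +
      complexity (Gsub K m (Sum.inl (e, false)))) ≤ 48 * m ^ 2 := by
    calc _ ≤ ∑ _e : E m, 12 := sum_le_sum fun e _ => hE e
      _ = 48 * m ^ 2 := by simp [Finset.card_univ]; ring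
  have hm : 48 * m ^ 2 ≤ 48 * (m + 1) ^ 2 := by gcongr; omega
  have hsq : 1 ≤ (m + 1) ^ 2 := Nat.one_le_pow _ _ (by omega)
  linarith [hsum, hT, hF, hm, hsq]

/-- **Circuit size of the layered polynomials**: `L(Φ m b) ≤ 62 m³`. [folklore] -/
theorem complexity_Φ_le (m : ℕ) (b : Bool) : complexity (Φ K m b) ≤ 62 * m ^ 3 := by
  induction m with
  | zero => simp only [Φ]; rw [complexity_X_holds]; exact Nat.zero_le _
  | succ m ih =>
    simp only [Φ]
    rw [← MvPolynomial.aeval_eq_bind₁]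
    calc _ ≤ complexity (Φ K m b) + ∑ v, complexity (Gsub K m v) := complexity_aeval_le _ _
      _ ≤ 62 * m ^ 3 + 62 * (m + 1) ^ 2 := add_le_add ih (sum_complexity_Gsub_le K m)
      _ ≤ 62 * (m + 1) ^ 3 := by
          have h1 : (m + 1) ^ 3 = m ^ 3 + 3 * m ^ 2 + 3 * m + 1 := by ring
          have h2 : (m + 1) ^ 2 = m ^ 2 + 2 * m + 1 := by ring
          rw [h1, h2]
          nlinarith [Nat.zero_le (m ^ 2), Nat.zero_le m]

end Complexity

end

end SquareGridDimers

end Summit.ValiantsHypothesis.ValiantsHypothesis.Theorems
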